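import Mathlib
import Summits.NavierStokesRegularity.NavierStokesRegularity.Theorems.TaoLadderRungTwoFlatEntryHop
import Summits.NavierStokesRegularity.NavierStokesRegularity.Theorems.TaoLadderRungTwoFlatHopTubeWith
import HarnessLib

/-!
# THE CAPTURE AND ENTRY LANDINGS FROM A PER-SITE DEVIATION PROFILE ON A PER-HOP WINDOW (referee c100 A-132 / theory-1 §69 A69-1, P-69a:
  the deviation certificate is `|S_{ik}(s) − Z_{ik}(s)| ≤ D_k ≤ D` site by site — small AHEAD, so the ahead window rows are satisfiable — and the
  good times live in a per-hop window `[t_lo, t_hi] ⊆ (0, c₀]`)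
  (helper for the K_A♭ parent item stmt-NavierStokesRegularity-22987 `FlatGapCertificatesV2`, child 2A `GradedAdiabaticWakeA` of route
  TaoLadderRungTwoFlat; cell harvest/h2-tao-ladder, p1 g25; LADDER §47.5, §50, §52)

`…CaptureDev` (p729827) took a UNIFORM deviation `D` on the global window `[t_lo, c₀]`: then the ahead window rows `8w_k(|Z| + D) ≤ r·AFL` are
infeasible (`D ≥ 5r/4`, `w ≥ 1`; TRAP #27 (b′)) and the reference rows over `[t_lo, c₀]` are too long for hops whose section window is narrow.
Here the deviation is a PROFILE `D_k` (`hdevk : |S_{ik}(s) − Z_{ik}(s)| ≤ D_k`, `D_k ≤ D`): the sup `D` feeds the capture / core / near / behind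
bookkeeping, the profile feeds the AHEAD rows (`8w_k(|Z_{i,1+k}| + D_{1+k}) ≤ r·AFL`, `|Z_{1,k_H+1}| + D_{k_H+1} ≤ V_top`); and the good times lie in
`[t_lo, t_hi]`, `t_hi ≤ c₀`, with every reference row over `[t_lo, t_hi]` only. Also the K4 capture short-horizon bound from an abstract
gauge-deviation certificate (referee c100 W-36).

* `tubeStepCaptureWith_of_devProfile`, `tubeStepLandWith_entry_of_devProfile`; `apriori_capture_of_dev`.

HONEST FRAMING: composition over the cell's typed induction frame (MODEL lattice, graded mirror table on `S♭`); the deviation, the reference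
rows and the budgets are HYPOTHESES; nothing certified; no item closed; nothing about the Navier–Stokes equations.
-/

noncomputable section

-- the sub-problem namespace repeats the summit name by design (D-0017)
set_option linter.dupNamespace false

namespace Summit.NavierStokesRegularity.NavierStokesRegularity.Theorems.HopTube

open Set Finset Literature.Analysis.FluidPDE Literature.Analysis.FluidPDE.TaoCascade MirrorPulse RenormFrame QuadPolar
  GappedFrontRobustOn

section DevProfile

variable {ε ε₀ : ℝ}

/-- **`TubeStepCaptureWith` AT THE CHOICE RULE, hop `n + 1 ≤ N₀`, FROM A DEVIATION PROFILE ON A PER-HOP WINDOW**: `|S_{ik} − Z_{ik}| ≤ D_k ≤ D` on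
`[0, c₀]` along every premise, good times in `[t_lo, t_hi] ⊆ (0, c₀]`, reference rows over `[t_lo, t_hi]`, the AHEAD rows with the profile. [cite: Tao2016AveragedNS, §6.2 Prop. 6.3 (ix), §6.3–6.4 (statement shape); route TaoLadderRungTwoFlat, `HopTube.TubeStepCaptureWith` (cell LADDER §47.5, §50)] -/
theorem tubeStepCaptureWith_of_devProfile (P : TubeSchedule) {Bcl : ℕ → (Fin 2 → ℤ → ℝ) → Prop} {i₀ : Fin 2}
    {X₀ : Fin 2 → ℝ} {w : ℤ → ℝ} {r θ₀ c₀ t₀ : ℝ} {ζ : ℕ → Fin 2 → ℤ → ℝ} {ustar : Fin 2 → ℤ → ℝ}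
    {good : ℕ → (Fin 2 → ℤ → ℝ → ℝ) → ℝ → Prop} {n : ℕ}
    (hε : 0 ≤ ε) (hε₀ : 0 < ε₀) (hn : n + 1 ≤ P.N₀) (hc₀ : 0 < c₀)
    (hζ0 : ζ 0 = datumState i₀ X₀) (hη0 : 0 ≤ P.η 0) (hk₁ : 1 ≤ P.k₁) (hr0 : 0 ≤ r)
    (hw1 : ∀ k, 1 ≤ w k) (hAstar : 0 < P.Astar)
    (hθ₀ : 0 ≤ θ₀) (hθ₀1 : θ₀ ≤ 1) (hAFL : 0 < 1 - θ₀ * ε₀)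
    -- the reference trajectory of the hop (any family of functions), its plain bound, and the DEVIATION of every premise from it
    {Z : Fin 2 → ℤ → ℝ → ℝ} {MZ D : ℝ} {Dk : ℤ → ℝ} (hZp : ∀ i k, ∀ t ∈ Icc 0 c₀, |Z i k t| ≤ MZ) (hDk : ∀ k, Dk k ≤ D)
    (hdevk : ∀ z S₀ τ S F, HopPremiseWith P Bcl shiftSetFlat ε₀ i₀ (mirrorTable ε ε) X₀ w r c₀ ζ ustar n z S₀ τ S F →
      ∀ (i : Fin 2) (k : ℤ), ∀ s ∈ Icc 0 c₀, |S i k s - Z i k s| ≤ Dk k)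
    -- good section times exist and lie in the clock window
    {tlo thi : ℝ} (htlo : 0 < tlo)
    (hex : ∀ z S₀ τ S F, HopPremiseWith P Bcl shiftSetFlat ε₀ i₀ (mirrorTable ε ε) X₀ w r c₀ ζ ustar n z S₀ τ S F →
      ∃ t, good n S t)
    (hwin : ∀ z S₀ τ S F, HopPremiseWith P Bcl shiftSetFlat ε₀ i₀ (mirrorTable ε ε) X₀ w r c₀ ζ ustar n z S₀ τ S F →
      ∀ t, good n S t → tlo ≤ t ∧ t ≤ thi) (hthi : thi ≤ c₀)
    -- CAPTURE: the reference-only row on the window and the budget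
    {ρ : ℝ} (href : ∀ t ∈ Icc tlo thi, ∀ (i : Fin 2) (k : ℤ),
      |Z i (1 + k) t / clampedRatio P i₀ ε₀ θ₀ t Z - ζ (n + 1) i k| ≤ ρ)
    (hbudget : D * (1 / (1 + ε₀) ^ (-θ₀) + MZ / (P.Astar * ((1 + ε₀) ^ (-θ₀)) ^ 2)) + ρ ≤ P.η (n + 1))
    -- AHEAD: window rows and window-top hull read off the reference (+ the profile); cut schedule
    {kH : ℤ} {Vtop : ℝ} {G Ω : ℤ → ℝ} (hk₁H : (P.k₁ : ℤ) ≤ kH + 2) (hVtop : 0 ≤ Vtop) (hG0 : ∀ j, kH < j → 0 ≤ G j)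
    (hrefA : ∀ t ∈ Icc tlo thi, ∀ (i : Fin 2) (k : ℤ), (P.k₁ : ℤ) ≤ k → k ≤ kH →
      8 * (w k * (|Z i (1 + k) t| + Dk (1 + k))) ≤ r * (1 - θ₀ * ε₀))
    (hrefV : ∀ t ∈ Icc 0 c₀, |Z 1 (kH + 1) t| + Dk (kH + 1) ≤ Vtop)
    (hΩ : ∀ j, kH < j → ∀ N : Finset ℤ, (∀ m ∈ N, j < m) → ∑ m ∈ N, (w m)⁻¹ ^ 2 ≤ Ω j)
    (hGΩ : ∀ j, kH < j → 2 * (9 / 8 * r) ^ 2 * Ω j ≤ G j ^ 2)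
    (hclose0 : 4 / 3 * c₀ * clock ε₀ (kH + 1) * Vtop * (Vtop + 2 * ε * G (kH + 1)) < G (kH + 1))
    (hcloseG : ∀ j, kH + 1 ≤ j →
      4 / 3 * c₀ * clock ε₀ (j + 1) * (2 * G j) * (2 * G j + 2 * ε * G (j + 1)) < G (j + 1))
    (hGr : ∀ k, kH < k → 8 * (w k * (2 * G k)) ≤ r * (1 - θ₀ * ε₀)) :
    TubeStepCaptureWith P Bcl (choiceRule P i₀ ε₀ θ₀ t₀ good) shiftSetFlat ε₀ i₀ (mirrorTable ε ε) X₀ w r c₀ ζ ustar n := by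
  have hε' : (-1 : ℝ) < ε₀ := by linarith
  have hw0 : ∀ k, 0 < w k := fun k => lt_of_lt_of_le one_pos (hw1 k)
  have hdev : ∀ z S₀ τ S F, HopPremiseWith P Bcl shiftSetFlat ε₀ i₀ (mirrorTable ε ε) X₀ w r c₀ ζ ustar n z S₀ τ S F →
      ∀ (i : Fin 2) (k : ℤ), ∀ s ∈ Icc 0 c₀, |S i k s - Z i k s| ≤ D :=
    fun z S₀ τ S F h i k s hs => (hdevk z S₀ τ S F h i k s hs).trans (hDk k)
  intro z S₀ τ S F hprem
  have hgood := chooseTime_spec (t₀ := t₀) (hex z S₀ τ S F hprem)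
  set t := chooseTime good t₀ n S with ht_def
  obtain ⟨htlo_le, hthi'⟩ := hwin z S₀ τ S F hprem t hgood
  have htc₀ : t ≤ c₀ := hthi'.trans hthi
  have htI : t ∈ Icc tlo thi := ⟨htlo_le, hthi'⟩
  have ht0 : t ∈ Icc 0 c₀ := ⟨htlo.le.trans htlo_le, htc₀⟩
  simp only [choiceRule_τ₁, choiceRule_a]
  refine ⟨fun i k => ?_, ?_⟩
  · -- CAPTURE at `n + 1`
    have hd := hdev z S₀ τ S F hprem
    exact (recentre_sub_le_of_dev P i₀ hε' hAstar (hd i₀ 1 t ht0) (hd i (1 + k) t ht0) (hZp i (1 + k) t ht0)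
      (href t htI i k)).trans hbudget
  · -- AHEAD of the landed state: the cut schedule with window rows and hull read off the reference
    have hwinA : AheadWindowWith P Bcl shiftSetFlat ε₀ i₀ (mirrorTable ε ε) X₀ w r c₀ ζ ustar good n kH (1 - θ₀ * ε₀) := by
      intro z' S₀' τ' S' F' hprem' t' ht' i k hk hkH
      obtain ⟨h1, h2⟩ := hwin z' S₀' τ' S' F' hprem' t' ht'
      have hd := hdevk z' S₀' τ' S' F' hprem' i (1 + k) t' ⟨htlo.le.trans h1, h2.trans hthi⟩
      have hS : |S' i (1 + k) t'| ≤ |Z i (1 + k) t'| + Dk (1 + k) := by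
        have := abs_sub_abs_le_abs_sub (S' i (1 + k) t') (Z i (1 + k) t'); linarith
      exact (mul_le_mul_of_nonneg_left (mul_le_mul_of_nonneg_left hS (hw0 k).le) (by norm_num)).trans
        (hrefA t' ⟨h1, h2⟩ i k hk hkH)
    have hVt : ∀ z S₀ τ S F, HopPremiseWith P Bcl shiftSetFlat ε₀ i₀ (mirrorTable ε ε) X₀ w r c₀ ζ ustar n z S₀ τ S F →
        ∀ t ∈ Icc 0 c₀, |S 1 (kH + 1) t| ≤ Vtop := by
      intro z' S₀' τ' S' F' hprem' t' ht'
      have hd := hdevk z' S₀' τ' S' F' hprem' 1 (kH + 1) t' ht'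
      have := abs_sub_abs_le_abs_sub (S' 1 (kH + 1) t') (Z 1 (kH + 1) t')
      linarith [hrefV t' ht']
    have hinit : ∀ j, kH < j → ∀ z S₀ τ S F,
        HopPremiseWith P Bcl shiftSetFlat ε₀ i₀ (mirrorTable ε ε) X₀ w r c₀ ζ ustar n z S₀ τ S F →
          ∀ N : Finset ℤ, (∀ m ∈ N, j < m) → ∑ m ∈ N, ∑ i : Fin 2, S₀ i m ^ 2 ≤ G j ^ 2 := by
      intro j hj z' S₀' τ' S' F' hprem' N hN
      obtain ⟨hz', hkick', -, -⟩ := hprem'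
      obtain ⟨-, hA'⟩ := capture_of_inTubeWith_le P (by omega) hζ0 hη0 hk₁ hr0 hz'
      exact (initialTail_le_of_clauses P hw0 hr0 hA' hkick' (by omega) hN (hΩ j hj N hN)).trans (hGΩ j hj)
    have hgoodI : ∀ z S₀ τ S F, HopPremiseWith P Bcl shiftSetFlat ε₀ i₀ (mirrorTable ε ε) X₀ w r c₀ ζ ustar n z S₀ τ S F →
        ∀ t, good n S t → t ∈ Icc 0 c₀ := fun z' S₀' τ' S' F' h' t' ht' =>
      ⟨htlo.le.trans (hwin z' S₀' τ' S' F' h' t' ht').1, (hwin z' S₀' τ' S' F' h' t' ht').2.trans hthi⟩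
    have hratio : ∀ z S₀ τ S F, HopPremiseWith P Bcl shiftSetFlat ε₀ i₀ (mirrorTable ε ε) X₀ w r c₀ ζ ustar n z S₀ τ S F →
        ∀ t, good n S t → 1 - θ₀ * ε₀ ≤ clampedRatio P i₀ ε₀ θ₀ t S :=
      fun z' S₀' τ' S' _ _ t' _ => one_sub_mul_le_clampedRatio P i₀ hε₀.le hθ₀ hθ₀1 t' S'
    exact aheadClause_of_schedule (a := fun S t => clampedRatio P i₀ ε₀ θ₀ t S) hε hε₀ hc₀.le hr0 (fun k => (hw0 k).le)
      hAFL hVtop hG0 hwinA hVt hinit hclose0 hcloseG hGr hgoodI hratio z S₀ τ S F hprem t hgood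

/-- **`TubeStepLandWith` OF THE SPLIT R54 TUBE AT THE ENTRY HOP `n = N₀`, FROM A DEVIATION PROFILE ON A PER-HOP WINDOW** (`|S_{ik} − Z_{ik}| ≤ D_k ≤ D`,
good times in `[t_lo, t_hi]`, reference rows over `[t_lo, t_hi]`, ahead rows with the profile), the (B2∃) cap, the cut schedule, `entryLanding_of_dev`.
[cite: Tao2016AveragedNS, §6.3–6.4 Props. 6.4–6.5 (statement shape); route TaoLadderRungTwoFlat, entry hop (cell LADDER §50, §52, §54, §64.2)] -/
theorem tubeStepLandWith_entry_of_devProfile (P : TubeSchedule) {δs : ℕ → ℝ} {θ' : ℝ} {Wb : ℕ → ℝ} {i₀ : Fin 2}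
    {X₀ : Fin 2 → ℝ} {w : ℤ → ℝ} {r θ₀ c₀ t₀ : ℝ} {ζ : ℕ → Fin 2 → ℤ → ℝ} {ustar : Fin 2 → ℤ → ℝ}
    {good : ℕ → (Fin 2 → ℤ → ℝ → ℝ) → ℝ → Prop}
    (hε : 0 ≤ ε) (hε₀ : 0 < ε₀) (hc₀ : 0 < c₀)
    (hζ0 : ζ 0 = datumState i₀ X₀) (hη0 : 0 ≤ P.η 0) (hk₁ : 1 ≤ P.k₁) (hr0 : 0 ≤ r)
    (hw1 : ∀ k, 1 ≤ w k) (hAstar : 0 < P.Astar) (hg : 1 ≤ P.g) (hb : 1 ≤ P.b)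
    (hθV : 0 ≤ P.θV) (hθ₀ : 0 ≤ θ₀) (hθ₀1 : θ₀ ≤ 1) (hAFL : 0 < 1 - θ₀ * ε₀)
    (hγ : 0 ≤ P.γ (P.N₀ + 1)) (hδ : 0 ≤ P.δ (P.N₀ + 1)) (hδs : 0 ≤ δs (P.N₀ + 1)) (hv : 0 ≤ P.v (P.N₀ + 1))
    (hWb : 0 ≤ Wb (P.N₀ + 1))
    -- the reference trajectory of the entry hop, its plain bound, and the DEVIATION of every premise from it
    {Z : Fin 2 → ℤ → ℝ → ℝ} {MZ D : ℝ} (hZp : ∀ i k, ∀ t ∈ Icc 0 c₀, |Z i k t| ≤ MZ)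
    {Dk : ℤ → ℝ} (hDk : ∀ k, Dk k ≤ D)
    (hdevk : ∀ z S₀ τ S F, HopPremiseWith P (splitBcl P (behindR54 P θ' Wb) δs i₀ ustar) shiftSetFlat ε₀ i₀ (mirrorTable ε ε) X₀ w
      r c₀ ζ ustar P.N₀ z S₀ τ S F → ∀ (i : Fin 2) (k : ℤ), ∀ s ∈ Icc 0 c₀, |S i k s - Z i k s| ≤ Dk k)
    -- good section times
    {tlo thi : ℝ} (htlo : 0 < tlo)
    (hex : ∀ z S₀ τ S F, HopPremiseWith P (splitBcl P (behindR54 P θ' Wb) δs i₀ ustar) shiftSetFlat ε₀ i₀ (mirrorTable ε ε) X₀ w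
      r c₀ ζ ustar P.N₀ z S₀ τ S F → ∃ t, good P.N₀ S t)
    (hwin : ∀ z S₀ τ S F, HopPremiseWith P (splitBcl P (behindR54 P θ' Wb) δs i₀ ustar) shiftSetFlat ε₀ i₀ (mirrorTable ε ε) X₀ w
      r c₀ ζ ustar P.N₀ z S₀ τ S F → ∀ t, good P.N₀ S t → tlo ≤ t ∧ t ≤ thi) (hthi : thi ≤ c₀)
    -- rows along the reference on the clock window; t-independent rows; budgets
    {δ₁ Mω δ₂ δ₃' ρN Mu : ℝ}
    (hrefC : ∀ t ∈ Icc tlo thi, P.Astar * (1 - P.γ (P.N₀ + 1)) * (1 + ε₀) ^ (-θ₀) + D ≤ |Z i₀ 1 t|)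
    (hrefW : ∀ t ∈ Icc tlo thi, ∀ (i : Fin 2) (k : ℤ), -(P.K : ℤ) ≤ k → k < (P.k₁ : ℤ) →
      MirrorPulse.geomGauge P.g P.b i k * |Z i (1 + k) t - |Z i₀ 1 t| / P.Astar * ustar i k| ≤ δ₁)
    (hMω : ∀ (i : Fin 2) (k : ℤ), -(P.K : ℤ) ≤ k → k < (P.k₁ : ℤ) → MirrorPulse.geomGauge P.g P.b i k * |ustar i k| ≤ Mω)
    (hdom : ∀ (i : Fin 2) (k : ℤ), (P.k₁ : ℤ) ≤ k →
      MirrorPulse.geomGauge P.g P.b i k * (max ((1 + ε₀) ^ (-θ₀)) ((MZ + D) / P.Astar) * r) ≤ 8 * δ₂ * w k)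
    (hutail : ∀ (i : Fin 2) (k : ℤ), (P.k₁ : ℤ) ≤ k → MirrorPulse.geomGauge P.g P.b i k * |ustar i k| ≤ δ₃')
    (hrefN : ∀ t ∈ Icc tlo thi, ∀ (i : Fin 2) (k : ℤ), -(P.D : ℤ) ≤ k → k ≤ -(P.K : ℤ) - 1 →
      |Z i (1 + k) t - |Z i₀ 1 t| / P.Astar * ustar i k| ≤ ρN)
    (hMu : ∀ (i : Fin 2) (k : ℤ), -(P.D : ℤ) ≤ k → k ≤ -(P.K : ℤ) - 1 → |ustar i k| ≤ Mu)
    (hrefB : ∀ t ∈ Icc tlo thi, ∀ L : ℕ,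
      R54.behindEnergy P.K L θ' (fun i k => |Z i (1 + k) t| + D) ≤ ((1 + ε₀) ^ (-θ₀)) ^ 2 * Wb (P.N₀ + 1))
    (hbudC : max (P.g ^ P.k₁ * D + δ₁ + D / P.Astar * Mω) (δ₂ + (MZ + D) / P.Astar * δ₃')
      ≤ (1 + ε₀) ^ (-θ₀) * P.δ (P.N₀ + 1))
    (hbudS : max (P.g ^ P.k₁ * D + δ₁ + D / P.Astar * Mω) (δ₂ + (MZ + D) / P.Astar * δ₃')
      ≤ (1 + ε₀) ^ (-θ₀) * δs (P.N₀ + 1))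
    (hbudN : ((Finset.Icc (-(P.D : ℤ)) (-(P.K : ℤ) - 1)).card : ℝ) * (D + ρN + D / P.Astar * Mu) ^ 2
      ≤ ((1 + ε₀) ^ (-θ₀)) ^ 2 * P.v (P.N₀ + 1))
    -- AHEAD: window rows and window-top hull read off the reference (+ the profile); cut schedule
    {kH : ℤ} {Vtop : ℝ} {G Ω : ℤ → ℝ} (hk₁H : (P.k₁ : ℤ) ≤ kH + 2) (hVtop : 0 ≤ Vtop) (hG0 : ∀ j, kH < j → 0 ≤ G j)
    (hrefA : ∀ t ∈ Icc tlo thi, ∀ (i : Fin 2) (k : ℤ), (P.k₁ : ℤ) ≤ k → k ≤ kH →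
      8 * (w k * (|Z i (1 + k) t| + Dk (1 + k))) ≤ r * (1 - θ₀ * ε₀))
    (hrefV : ∀ t ∈ Icc 0 c₀, |Z 1 (kH + 1) t| + Dk (kH + 1) ≤ Vtop)
    (hΩ : ∀ j, kH < j → ∀ N : Finset ℤ, (∀ m ∈ N, j < m) → ∑ m ∈ N, (w m)⁻¹ ^ 2 ≤ Ω j)
    (hGΩ : ∀ j, kH < j → 2 * (9 / 8 * r) ^ 2 * Ω j ≤ G j ^ 2)
    (hclose0 : 4 / 3 * c₀ * clock ε₀ (kH + 1) * Vtop * (Vtop + 2 * ε * G (kH + 1)) < G (kH + 1))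
    (hcloseG : ∀ j, kH + 1 ≤ j →
      4 / 3 * c₀ * clock ε₀ (j + 1) * (2 * G j) * (2 * G j + 2 * ε * G (j + 1)) < G (j + 1))
    (hGr : ∀ k, kH < k → 8 * (w k * (2 * G k)) ≤ r * (1 - θ₀ * ε₀)) :
    TubeStepLandWith P (splitBcl P (behindR54 P θ' Wb) δs i₀ ustar) (choiceRule P i₀ ε₀ θ₀ t₀ good) shiftSetFlat ε₀ i₀
      (mirrorTable ε ε) X₀ w r c₀ ζ ustar P.N₀ := by
  have hε' : (-1 : ℝ) < ε₀ := by linarith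
  have hw0 : ∀ k, 0 < w k := fun k => lt_of_lt_of_le one_pos (hw1 k)
  have hdev : ∀ z S₀ τ S F, HopPremiseWith P (splitBcl P (behindR54 P θ' Wb) δs i₀ ustar) shiftSetFlat ε₀ i₀ (mirrorTable ε ε) X₀ w
      r c₀ ζ ustar P.N₀ z S₀ τ S F → ∀ (i : Fin 2) (k : ℤ), ∀ s ∈ Icc 0 c₀, |S i k s - Z i k s| ≤ D :=
    fun z S₀ τ S F h i k s hs => (hdevk z S₀ τ S F h i k s hs).trans (hDk k)
  -- AHEAD of the landed state along every premise at every good time (cut schedule)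
  have hwinA : AheadWindowWith P (splitBcl P (behindR54 P θ' Wb) δs i₀ ustar) shiftSetFlat ε₀ i₀ (mirrorTable ε ε) X₀ w r c₀ ζ
      ustar good P.N₀ kH (1 - θ₀ * ε₀) := by
    intro z S₀ τ S F hprem t ht i k hk hkH
    obtain ⟨h1, h2⟩ := hwin z S₀ τ S F hprem t ht
    have hd := hdevk z S₀ τ S F hprem i (1 + k) t ⟨htlo.le.trans h1, h2.trans hthi⟩
    have hS : |S i (1 + k) t| ≤ |Z i (1 + k) t| + Dk (1 + k) := by
      have := abs_sub_abs_le_abs_sub (S i (1 + k) t) (Z i (1 + k) t); linarith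
    exact (mul_le_mul_of_nonneg_left (mul_le_mul_of_nonneg_left hS (hw0 k).le) (by norm_num)).trans
      (hrefA t ⟨h1, h2⟩ i k hk hkH)
  have hVt : ∀ z S₀ τ S F, HopPremiseWith P (splitBcl P (behindR54 P θ' Wb) δs i₀ ustar) shiftSetFlat ε₀ i₀ (mirrorTable ε ε) X₀
      w r c₀ ζ ustar P.N₀ z S₀ τ S F → ∀ t ∈ Icc 0 c₀, |S 1 (kH + 1) t| ≤ Vtop := by
    intro z S₀ τ S F hprem t ht
    have hd := hdevk z S₀ τ S F hprem 1 (kH + 1) t ht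
    have := abs_sub_abs_le_abs_sub (S 1 (kH + 1) t) (Z 1 (kH + 1) t)
    linarith [hrefV t ht]
  have hinit : ∀ j, kH < j → ∀ z S₀ τ S F,
      HopPremiseWith P (splitBcl P (behindR54 P θ' Wb) δs i₀ ustar) shiftSetFlat ε₀ i₀ (mirrorTable ε ε) X₀ w r c₀ ζ ustar P.N₀
        z S₀ τ S F → ∀ N : Finset ℤ, (∀ m ∈ N, j < m) → ∑ m ∈ N, ∑ i : Fin 2, S₀ i m ^ 2 ≤ G j ^ 2 := by
    intro j hj z S₀ τ S F hprem N hN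
    obtain ⟨hz, hkick, -, -⟩ := hprem
    obtain ⟨-, hA⟩ := capture_of_inTubeWith_le P le_rfl hζ0 hη0 hk₁ hr0 hz
    exact (initialTail_le_of_clauses P hw0 hr0 hA hkick (by omega) hN (hΩ j hj N hN)).trans (hGΩ j hj)
  have hgoodI : ∀ z S₀ τ S F, HopPremiseWith P (splitBcl P (behindR54 P θ' Wb) δs i₀ ustar) shiftSetFlat ε₀ i₀ (mirrorTable ε ε)
      X₀ w r c₀ ζ ustar P.N₀ z S₀ τ S F → ∀ t, good P.N₀ S t → t ∈ Icc 0 c₀ := fun z S₀ τ S F h t ht =>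
    ⟨htlo.le.trans (hwin z S₀ τ S F h t ht).1, (hwin z S₀ τ S F h t ht).2.trans hthi⟩
  have hratio : ∀ z S₀ τ S F, HopPremiseWith P (splitBcl P (behindR54 P θ' Wb) δs i₀ ustar) shiftSetFlat ε₀ i₀ (mirrorTable ε ε)
      X₀ w r c₀ ζ ustar P.N₀ z S₀ τ S F → ∀ t, good P.N₀ S t → 1 - θ₀ * ε₀ ≤ clampedRatio P i₀ ε₀ θ₀ t S :=
    fun z S₀ τ S _ _ t _ => one_sub_mul_le_clampedRatio P i₀ hε₀.le hθ₀ hθ₀1 t S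
  have hahead := aheadClause_of_schedule (a := fun S t => clampedRatio P i₀ ε₀ θ₀ t S) hε hε₀ hc₀.le hr0 (fun k => (hw0 k).le)
    hAFL hVtop hG0 hwinA hVt hinit hclose0 hcloseG hGr hgoodI hratio
  -- the landing at the chosen good time
  intro z S₀ τ S F hprem
  have hgood := chooseTime_spec (t₀ := t₀) (hex z S₀ τ S F hprem)
  set t := chooseTime good t₀ P.N₀ S with ht_def
  obtain ⟨htlo_le, hthi'⟩ := hwin z S₀ τ S F hprem t hgood
  have htc₀ : t ≤ c₀ := hthi'.trans hthi
  have ht0 : t ∈ Icc 0 c₀ := ⟨htlo.le.trans htlo_le, htc₀⟩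
  have htI : t ∈ Icc tlo thi := ⟨htlo_le, hthi'⟩
  have hd : ∀ (i : Fin 2) (k : ℤ), |S i k t - Z i k t| ≤ D := fun i k => hdev z S₀ τ S F hprem i k t ht0
  have hcap : ∃ Λ : ℝ, 0 ≤ Λ ∧ R54.BehindCapClause P.K Λ (recentre S t (clampedRatio P i₀ ε₀ θ₀ t S)) := by
    obtain ⟨-, -, hc₀τ, hflow⟩ := hprem
    exact R54.exists_behindCap_recentre hflow hε'.le ⟨ht0.1, htc₀.trans hc₀τ⟩ (clampedRatio_pos P i₀ hε' θ₀ t S) P.K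
  have hL := entryLanding_of_dev (δs := δs) (θ' := θ') (Wb := Wb) P hε₀ hAstar hg hb hθV hw0 hr0 hγ hδ hδs hv hWb hd
    (fun i k => hZp i k t ht0) hcap (hahead z S₀ τ S F hprem t hgood) (hrefC t htI) (hrefW t htI) hMω hdom hutail (hrefN t htI)
    hMu (hrefB t htI) hbudC hbudS hbudN
  simp only [choiceRule_τ₁, choiceRule_a]
  exact hL

/-- **K4 CAPTURE PHASE FROM AN ABSTRACT GAUGE-DEVIATION CERTIFICATE** (referee c100 W-36): if every exact flow from a ball state of hop `n` on
`[0, s] ⊆ [0, c₀]` stays within `D_ω` of the reference in the gauge `ω` (any certificate — the Grönwall form `gauge_deviation_of_gradedFlows_free`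
or an E2 enclosure), and the ball states start within `D_ω` of `Z(0)`, then `ω|S₀|, ω|S| ≤ M_Z^ω + D_ω`: the short-horizon `hapr` input of
`tubeExistWith_of_phases` at that hop. [cite: Tao2016AveragedNS, §4 Lemma 4.1 (4.5), (4.12); route TaoLadderRungTwoFlat, `HopTube.TubeExistWith` (cell LADDER §47.5 L2, K4)] -/
theorem apriori_capture_of_dev (P : TubeSchedule) {Bcl : ℕ → (Fin 2 → ℤ → ℝ) → Prop} {i₀ : Fin 2} {X₀ : Fin 2 → ℝ}
    {w ω : ℤ → ℝ} {r c₀ : ℝ} {ζ : ℕ → Fin 2 → ℤ → ℝ} {ustar : Fin 2 → ℤ → ℝ} {n : ℕ} {Z : Fin 2 → ℤ → ℝ → ℝ} {MZω Dω : ℝ}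
    (hc₀ : 0 ≤ c₀) (hω0 : ∀ k, 0 ≤ ω k) (hZω : ∀ i k, ∀ t ∈ Icc 0 c₀, ω k * |Z i k t| ≤ MZω)
    (hdev0 : ∀ z S₀ : Fin 2 → ℤ → ℝ, InTubeWith P Bcl i₀ X₀ w r ζ ustar n z → (∀ i k, w k * |S₀ i k - z i k| ≤ r) →
      ∀ (i : Fin 2) (k : ℤ), ω k * |S₀ i k - Z i k 0| ≤ Dω)
    (hdevω : ∀ z S₀ s S F, InTubeWith P Bcl i₀ X₀ w r ζ ustar n z → (∀ i k, w k * |S₀ i k - z i k| ≤ r) → 0 < s → s ≤ c₀ →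
      PseudoFlowOnShift shiftSetFlat s ε₀ (mirrorTable ε ε) 0 0 S₀ (fun i k => (1 / 2) * S₀ i k ^ 2) (fun _ _ => 0) S F →
        ∀ t ∈ Icc 0 s, ∀ (i : Fin 2) (k : ℤ), ω k * |S i k t - Z i k t| ≤ Dω)
    {z S₀ : Fin 2 → ℤ → ℝ} (hz : InTubeWith P Bcl i₀ X₀ w r ζ ustar n z) (hkick : ∀ i k, w k * |S₀ i k - z i k| ≤ r) :
    (∀ (i : Fin 2) (k : ℤ), ω k * |S₀ i k| ≤ MZω + Dω) ∧
      ∀ s : ℝ, 0 < s → s ≤ c₀ → ∀ S F : Fin 2 → ℤ → ℝ → ℝ,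
        PseudoFlowOnShift shiftSetFlat s ε₀ (mirrorTable ε ε) 0 0 S₀ (fun i k => (1 / 2) * S₀ i k ^ 2) (fun _ _ => 0) S F →
          ∀ t ∈ Icc 0 s, ∀ (i : Fin 2) (k : ℤ), ω k * |S i k t| ≤ MZω + Dω := by
  refine ⟨fun i k => ?_, fun s hs hsc S F hS t ht i k => ?_⟩
  · have h1 := hdev0 z S₀ hz hkick i k
    have h2 := hZω i k 0 ⟨le_rfl, hc₀⟩
    have htri := abs_sub_abs_le_abs_sub (S₀ i k) (Z i k 0)
    nlinarith [hω0 k]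
  · have h1 := hdevω z S₀ s S F hz hkick hs hsc hS t ht i k
    have h2 := hZω i k t ⟨ht.1, ht.2.trans hsc⟩
    have htri := abs_sub_abs_le_abs_sub (S i k t) (Z i k t)
    nlinarith [hω0 k]

end DevProfile

end Summit.NavierStokesRegularity.NavierStokesRegularity.Theorems.HopTube

end
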